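import Mathlib
import Summits.CriticalPhenomena.PercolationContinuityZ3.Theorems.PercNearOneGluingNoHeavyLowerTailOrientedAntipodalHallFullStarKleitman
import HarnessLib
import HarnessLib.Audit

/-!
# Conjecture K and the sharper Conjecture K♯ ("paired sunflowers") as typed targets; K♯ ⟹ K; the two-petal case of K♯

Support file for crux `stmt-CriticalPhenomena-4575` (`NoHeavyLowerTail`, route `PercNearOneGluingNoHeavy`), hull-port seat `prim-hp-7`
(generation 62); `--supports stmt-CriticalPhenomena-4575`.  No `sorry`.  The `@[conjecture]` definition is an OBLIGATION of this programme
(exactly certified for small cubes, unproved), never a fact; it is only ever used as an explicit hypothesis.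
Memos: `run/shared/lean/prim/prim-hp-7/FROM-prim-hp-7-g59-T6-EXACT.md` §3 (Conjecture K, FS, FS′) and
`run/shared/lean/prim/prim-hp-7/FROM-prim-hp-7-g62-KSHARP-CONES.md` (K♯, the 2/3 barrier for kernel certificates).

**Setting** (vocabulary of `…AntipodalStrongHarris` / `…OrientedAntipodalHall`): two monotone labellings `g h : Finset α → Lab k` of the
subsets of a finite type (`B < C_a < A`), complements `qᶜ = univ \ q`.  The PETAL ZONE of `a` is `Z_a = {q : h q ≤ C_a ≤ g q}`; the
CORE is `𝒦 = {q : g q = A, h q = B} = Z_a ∩ Z_b` (`a ≠ b`); a set `q` is CHARGED if `q ∈ Z_a` and `qᶜ ∈ Z_b` for some `a ≠ b`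
(then so is `qᶜ`); it is a GOOD if `g q = A` and `h qᶜ = B`.  For `(g,h) = (f(· ∪ {e}), f)` these are the complement pairs at `e`
containing a bad / a good set of the labelling `f` (memo g59 §3).

* `ConjK k` — hp-7's **Conjecture K** (g59), in ordered-set form: `#{q charged, not (q ∈ 𝒦 ∧ qᶜ ∈ 𝒦)} ≤ 2 · #{goods}`
  (`= 2Γ`; the left side is `2ν`).  K ⟹ FS′ ⟹ FS (the full-star count).  Exactly certified (SAT) for all pairs `(g,h)` on `2^m`, `m ≤ 6`
  (kit j177124), `k = 3`.
* `KSharp k` — **Conjecture K♯** (g62): `#{q charged} ≤ #{q : q good ∨ qᶜ good}`, i.e. charged complement PAIRS (core–core pairs included)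
  are at most the complement pairs containing a good.  K♯ restricted to `h ≡ B` or to `g = h` is exactly the antipodal strong Harris
  inequality; it is equivalent to the 'paired sunflower' statement PS₃ and to the hexagon statement K_M of the g62 memo.  Exhaustive for
  `m ≤ 3`, exact SAT for all pairs on `2^m`, `m ≤ 5` (kit j184796), annealing to `m = 6`; `@[conjecture] ConjectureKSharp := KSharp 3`.
* `conjK_of_kSharp` — K♯ ⟹ K (the core–core charged sets are exactly the sets `q` with `q, qᶜ` both good).
* `kSharp_two` — K♯ holds for TWO petals (`k = 2`): it is `card_straddle_pairs_le_card_goods` (Harris–Kleitman) plus the identity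
  'charged ∩ charged* = good ∩ good*'.
NO level-1 or level-2 Harris/Kleitman/ASH kernel certificate proves K or K♯ for three petals (best constant exactly 2/3, memo g62 §0, §5).
-/

namespace Summit.CriticalPhenomena.PercolationContinuityZ3.Theorems

namespace OrientedAntipodalHall

open Finset AntipodalStrongHarris AntipodalStrongHarris.Lab

section Defs

variable (k : ℕ)

/-- The set `q` is CHARGED for the pair of labellings `(g,h)`: for some petals `a ≠ b`, `h q ≤ C_a ≤ g q` and `h qᶜ ≤ C_b ≤ g qᶜ`
(spelled out as label equalities; `qᶜ = univ \ q`). -/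
def IsCharged {α : Type*} [Fintype α] [DecidableEq α] (g h : Finset α → Lab k) (q : Finset α) : Prop :=
  ∃ a b : Fin k, a ≠ b ∧ (g q = petal a ∨ g q = top) ∧ (h q = bot ∨ h q = petal a) ∧
    (g (univ \ q) = petal b ∨ g (univ \ q) = top) ∧ (h (univ \ q) = bot ∨ h (univ \ q) = petal b)

/-- Being charged is decidable (finitely many petal pairs, decidable label equalities). -/
instance {α : Type*} [Fintype α] [DecidableEq α] (g h : Finset α → Lab k) (q : Finset α) :
    Decidable (IsCharged k g h q) := by
  unfold IsCharged; infer_instance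

/-- **Conjecture K** of hp-7 g59 (ordered-set form `2ν ≤ 2Γ`): for monotone `g, h`, the charged sets `q` that are not 'core–core'
(`g = A, h = B` at both `q` and `qᶜ`) number at most twice the good sets (`g q = A`, `h qᶜ = B`).  An obligation, not a fact. -/
def ConjK : Prop :=
  ∀ (α : Type) [Fintype α] [DecidableEq α] (g h : Finset α → Lab k),
    (∀ ⦃X Y : Finset α⦄, X ⊆ Y → g X ≤ g Y) → (∀ ⦃X Y : Finset α⦄, X ⊆ Y → h X ≤ h Y) →
      #{q ∈ (univ : Finset (Finset α)) | IsCharged k g h q ∧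
          ¬ (g q = top ∧ h q = bot ∧ g (univ \ q) = top ∧ h (univ \ q) = bot)} ≤
        2 * #{q ∈ (univ : Finset (Finset α)) | g q = top ∧ h (univ \ q) = bot}

/-- **Conjecture K♯** of hp-7 g62 (ordered-set form): for monotone `g, h`, the charged sets number at most the sets `q` such that `q`
or `qᶜ` is good.  Equivalent to the paired-sunflower statement PS₃ / hexagon statement K_M of the g62 memo; implies `ConjK`
(`conjK_of_kSharp`); its restrictions to `h ≡ B` and to `g = h` are the antipodal strong Harris inequality.  An obligation, not a fact. -/
def KSharp : Prop :=
  ∀ (α : Type) [Fintype α] [DecidableEq α] (g h : Finset α → Lab k),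
    (∀ ⦃X Y : Finset α⦄, X ⊆ Y → g X ≤ g Y) → (∀ ⦃X Y : Finset α⦄, X ⊆ Y → h X ≤ h Y) →
      #{q ∈ (univ : Finset (Finset α)) | IsCharged k g h q} ≤
        #{q ∈ (univ : Finset (Finset α)) | (g q = top ∧ h (univ \ q) = bot) ∨ (g (univ \ q) = top ∧ h q = bot)}

end Defs

/-- **CONJECTURE K♯ for three petals** (hp-7 g62): `KSharp 3`.  Exhaustively verified for all pairs of labellings of `2^m`, `m ≤ 3`
(529,984 pairs), exactly by SAT for `m ≤ 5` (kit j184796), by annealing to `m = 6`; no level-≤2 kernel certificate exists (best constant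
2/3, memo g62).  Implies Conjecture K, FS′ and the full-star count FS. [this work; obligation] -/
@[conjecture] def ConjectureKSharp : Prop := KSharp 3

section Consequences

variable {k : ℕ}

/-- A core–core set (`g = A`, `h = B` at `q` and at `qᶜ`) is charged as soon as there are two petals. -/
theorem isCharged_of_core {α : Type*} [Fintype α] [DecidableEq α] {g h : Finset α → Lab k} {q : Finset α}
    {a b : Fin k} (hab : a ≠ b)
    (h1 : g q = top) (h2 : h q = bot) (h3 : g (univ \ q) = top) (h4 : h (univ \ q) = bot) : IsCharged k g h q :=
  ⟨a, b, hab, Or.inr h1, Or.inl h2, Or.inr h3, Or.inl h4⟩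

/-- **K♯ ⟹ K.**  The charged sets that are not core–core are (charged) minus (core–core); the sets with `q` or `qᶜ` good are
`#goods + #goods* − #(good ∩ good*)`, and `good ∩ good* = core–core`, `#goods* = #goods`. -/
theorem conjK_of_kSharp (hK : KSharp k) : ConjK k := by
  intro α _ _ g h hg hh
  classical
  have hmain := hK α g h hg hh
  -- notation
  set U : Finset (Finset α) := univ with hU
  set Ch : Finset (Finset α) := {q ∈ U | IsCharged k g h q} with hCh
  set CC : Finset (Finset α) := {q ∈ U | g q = top ∧ h q = bot ∧ g (univ \ q) = top ∧ h (univ \ q) = bot} with hCC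
  set Gd : Finset (Finset α) := {q ∈ U | g q = top ∧ h (univ \ q) = bot} with hGd
  set Gs : Finset (Finset α) := {q ∈ U | g (univ \ q) = top ∧ h q = bot} with hGs
  have hcc : ∀ q : Finset α, univ \ (univ \ q) = q := fun q => by
    rw [Finset.sdiff_sdiff_eq_self (subset_univ q)]
  -- the left side of K is #(Ch \ CC) when CC ⊆ Ch, and in general #{charged ∧ ¬cc} = #Ch - #(Ch ∩ CC)
  have hL : {q ∈ U | IsCharged k g h q ∧ ¬ (g q = top ∧ h q = bot ∧ g (univ \ q) = top ∧ h (univ \ q) = bot)} = Ch \ CC := by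
    ext q; simp [hCh, hCC, hU, mem_sdiff]
  -- the right side of K♯ is #(Gd ∪ Gs)
  have hR : {q ∈ U | (g q = top ∧ h (univ \ q) = bot) ∨ (g (univ \ q) = top ∧ h q = bot)} = Gd ∪ Gs := by
    ext q; simp [hGd, hGs, hU, mem_union]
  rw [hL]
  rw [hR] at hmain
  -- Gd ∩ Gs = CC
  have hGG : Gd ∩ Gs = CC := by
    ext q; simp only [hGd, hGs, hCC, hU, mem_inter, mem_filter, mem_univ, true_and]
    constructor
    · rintro ⟨⟨h1, h2⟩, h3, h4⟩; exact ⟨h1, h4, h3, h2⟩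
    · rintro ⟨h1, h2, h3, h4⟩; exact ⟨⟨h1, h4⟩, h3, h2⟩
  -- #Gs = #Gd via the reflection q ↦ univ \ q
  have hGsGd : #Gs = #Gd := by
    have : Gs = Gd.image (fun q => univ \ q) := by
      ext q
      simp only [hGs, hGd, hU, mem_filter, mem_univ, true_and, mem_image]
      constructor
      · rintro ⟨h1, h2⟩
        exact ⟨univ \ q, ⟨h1, by rw [hcc]; exact h2⟩, hcc q⟩
      · rintro ⟨r, ⟨h1, h2⟩, rfl⟩
        rw [hcc]; exact ⟨h1, h2⟩
    rw [this]
    refine card_image_of_injOn fun q _ r _ hqr => ?_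
    have := congrArg (fun s => (univ : Finset α) \ s) hqr
    simpa only [hcc] using this
  have hunion : #(Gd ∪ Gs) + #CC = #Gd + #Gs := by
    rw [← hGG]; exact card_union_add_card_inter Gd Gs
  have hsd : #(Ch \ CC) + #(Ch ∩ CC) = #Ch := by
    rw [← card_sdiff_add_card_inter Ch CC]
  have hint : #(Ch ∩ CC) ≤ #CC := card_le_card inter_subset_right
  omega

end Consequences

section TwoPetals

variable {α : Type*} [Fintype α] [DecidableEq α]

/-- For `k = 2`, the charged sets split by the petal of `q`: `E = {q ∈ Z₀, qᶜ ∈ Z₁}` and its reflection. -/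
theorem isCharged_two_iff (g h : Finset α → Lab 2) (q : Finset α) :
    IsCharged 2 g h q ↔
      ((g q = petal 0 ∨ g q = top) ∧ (h q = bot ∨ h q = petal 0) ∧
          (g (univ \ q) = petal 1 ∨ g (univ \ q) = top) ∧ (h (univ \ q) = bot ∨ h (univ \ q) = petal 1)) ∨
      ((g q = petal 1 ∨ g q = top) ∧ (h q = bot ∨ h q = petal 1) ∧
          (g (univ \ q) = petal 0 ∨ g (univ \ q) = top) ∧ (h (univ \ q) = bot ∨ h (univ \ q) = petal 0)) := by
  constructor
  · rintro ⟨a, b, hab, h1, h2, h3, h4⟩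
    fin_cases a <;> fin_cases b
    · exact absurd rfl hab
    · exact Or.inl ⟨h1, h2, h3, h4⟩
    · exact Or.inr ⟨h1, h2, h3, h4⟩
    · exact absurd rfl hab
  · rintro (⟨h1, h2, h3, h4⟩ | ⟨h1, h2, h3, h4⟩)
    · exact ⟨0, 1, by decide, h1, h2, h3, h4⟩
    · exact ⟨1, 0, by decide, h1, h2, h3, h4⟩

/-- **Conjecture K♯ holds for two petals** (`k = 2`): charged = `E ∪ E*` with `E = {q ∈ Z₀ : qᶜ ∈ Z₁}`, goods-or-reflected
= `G ∪ G*`, `#E ≤ #G` by `card_straddle_pairs_le_card_goods` (Harris–Kleitman), and `E ∩ E* = G ∩ G*` (both are the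
core–core sets). -/
theorem kSharp_two : KSharp 2 := by
  intro β _ _ g h hg hh
  classical
  have hcc : ∀ q : Finset β, univ \ (univ \ q) = q := fun q => by
    rw [Finset.sdiff_sdiff_eq_self (subset_univ q)]
  -- the four families
  obtain ⟨E, hE⟩ : ∃ E : Finset (Finset β), E = {q ∈ (univ : Finset (Finset β)) | (g q = petal 0 ∨ g q = top) ∧
      (h q = bot ∨ h q = petal 0) ∧ (g (univ \ q) = petal 1 ∨ g (univ \ q) = top) ∧ (h (univ \ q) = bot ∨ h (univ \ q) = petal 1)} :=
    ⟨_, rfl⟩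
  obtain ⟨E', hE'⟩ : ∃ E' : Finset (Finset β), E' = {q ∈ (univ : Finset (Finset β)) | (g q = petal 1 ∨ g q = top) ∧
      (h q = bot ∨ h q = petal 1) ∧ (g (univ \ q) = petal 0 ∨ g (univ \ q) = top) ∧ (h (univ \ q) = bot ∨ h (univ \ q) = petal 0)} :=
    ⟨_, rfl⟩
  obtain ⟨Gd, hGd⟩ : ∃ Gd : Finset (Finset β), Gd = {q ∈ (univ : Finset (Finset β)) | g q = top ∧ h (univ \ q) = bot} := ⟨_, rfl⟩
  obtain ⟨Gs, hGs⟩ : ∃ Gs : Finset (Finset β), Gs = {q ∈ (univ : Finset (Finset β)) | g (univ \ q) = top ∧ h q = bot} := ⟨_, rfl⟩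
  have hmemE : ∀ q, q ∈ E ↔ (g q = petal 0 ∨ g q = top) ∧ (h q = bot ∨ h q = petal 0) ∧
      (g (univ \ q) = petal 1 ∨ g (univ \ q) = top) ∧ (h (univ \ q) = bot ∨ h (univ \ q) = petal 1) := fun q => by
    rw [hE, mem_filter]; simp only [mem_univ, true_and]
  have hmemE' : ∀ q, q ∈ E' ↔ (g q = petal 1 ∨ g q = top) ∧ (h q = bot ∨ h q = petal 1) ∧
      (g (univ \ q) = petal 0 ∨ g (univ \ q) = top) ∧ (h (univ \ q) = bot ∨ h (univ \ q) = petal 0) := fun q => by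
    rw [hE', mem_filter]; simp only [mem_univ, true_and]
  have hmemGd : ∀ q, q ∈ Gd ↔ g q = top ∧ h (univ \ q) = bot := fun q => by
    rw [hGd, mem_filter]; simp only [mem_univ, true_and]
  have hmemGs : ∀ q, q ∈ Gs ↔ g (univ \ q) = top ∧ h q = bot := fun q => by
    rw [hGs, mem_filter]; simp only [mem_univ, true_and]
  have hL : {q ∈ (univ : Finset (Finset β)) | IsCharged 2 g h q} = E ∪ E' := by
    ext q; rw [mem_filter, mem_union, hmemE, hmemE', isCharged_two_iff]; simp only [mem_univ, true_and]
  have hR : {q ∈ (univ : Finset (Finset β)) | (g q = top ∧ h (univ \ q) = bot) ∨ (g (univ \ q) = top ∧ h q = bot)} = Gd ∪ Gs := by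
    ext q; rw [mem_filter, mem_union, hmemGd, hmemGs]; simp only [mem_univ, true_and]
  rw [hL, hR]
  -- #E ≤ #Gd (Harris–Kleitman) ; reflections
  have h01 : (0 : Fin 2) ≠ 1 := by decide
  have hEG : #E ≤ #Gd := by rw [hE, hGd]; exact card_straddle_pairs_le_card_goods g h hg hh h01
  have hinj : ∀ q r : Finset β, univ \ q = univ \ r → q = r := fun q r hqr => by
    have := congrArg (fun s => (univ : Finset β) \ s) hqr
    simpa only [hcc] using this
  have hE'eq : E' = E.image (fun q => univ \ q) := by
    ext q
    rw [hmemE', mem_image]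
    constructor
    · rintro ⟨h1, h2, h3, h4⟩
      exact ⟨univ \ q, (hmemE _).2 ⟨h3, h4, by rw [hcc]; exact h1, by rw [hcc]; exact h2⟩, hcc q⟩
    · rintro ⟨r, hr, rfl⟩
      obtain ⟨h1, h2, h3, h4⟩ := (hmemE r).1 hr
      rw [hcc]; exact ⟨h3, h4, h1, h2⟩
  have hGseq : Gs = Gd.image (fun q => univ \ q) := by
    ext q
    rw [hmemGs, mem_image]
    constructor
    · rintro ⟨h1, h2⟩
      exact ⟨univ \ q, (hmemGd _).2 ⟨h1, by rw [hcc]; exact h2⟩, hcc q⟩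
    · rintro ⟨r, hr, rfl⟩
      obtain ⟨h1, h2⟩ := (hmemGd r).1 hr
      rw [hcc]; exact ⟨h1, h2⟩
  have hcE' : #E' = #E := by
    rw [hE'eq]; exact card_image_of_injOn fun q _ r _ hqr => hinj q r hqr
  have hcGs : #Gs = #Gd := by
    rw [hGseq]; exact card_image_of_injOn fun q _ r _ hqr => hinj q r hqr
  -- E ∩ E' = Gd ∩ Gs : both are the core–core sets
  have hne : (petal 0 : Lab 2) ≠ petal 1 := by decide
  have hpt : ∀ x : Lab 2, (x = petal 0 ∨ x = top) → (x = petal 1 ∨ x = top) → x = top := by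
    rintro x (h1 | h1) (h2 | h2)
    · exact absurd (h1.symm.trans h2) hne
    · exact h2
    · exact h1
    · exact h1
  have hnb1 : (petal 0 : Lab 2) ≠ petal 1 := by decide
  have hpb : ∀ x : Lab 2, (x = bot ∨ x = petal 0) → (x = bot ∨ x = petal 1) → x = bot := by
    rintro x (h1 | h1) (h2 | h2)
    · exact h1
    · exact h1
    · exact h2
    · exact absurd (h1.symm.trans h2) hnb1
  have hint : E ∩ E' = Gd ∩ Gs := by
    ext q
    rw [mem_inter, mem_inter, hmemE, hmemE', hmemGd, hmemGs]
    constructor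
    · rintro ⟨⟨h1, h2, h3, h4⟩, h1', h2', h3', h4'⟩
      exact ⟨⟨hpt _ h1 h1', hpb _ h4' h4⟩, hpt _ h3' h3, hpb _ h2 h2'⟩
    · rintro ⟨⟨h1, h4⟩, h3, h2⟩
      exact ⟨⟨Or.inr h1, Or.inl h2, Or.inr h3, Or.inl h4⟩, Or.inr h1, Or.inl h2, Or.inr h3, Or.inl h4⟩
  have hu1 := card_union_add_card_inter E E'
  have hu2 := card_union_add_card_inter Gd Gs
  rw [hint] at hu1
  omega

end TwoPetals

end OrientedAntipodalHall

end Summit.CriticalPhenomena.PercolationContinuityZ3.Theorems
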